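import Summits.BirchSwinnertonDyer.Rank1Residual.GaloisImage.KatoZetaValueDerivativeCongruenceOfZetaBody
import HarnessLib

/-!
# Route `KimAtThreeKolyvagin` (W2): the derivative congruence for Kato's zeta value with the `p`-Euler
# factor kept as a FACTOR — the value side of the Kato–Kurihara port on the good ANOMALOUS rows at `3`

Cell `bsd-addord`, seat `bsd-addord-w2-c4` (gen 9; owner of crux 19599 `ShallowEqDeepOffKatoStratum`, item
19077 `ShallowEqDeepAtTorsionFree`).  `--supports` 19599.  HONEST FRAMING: TOOL THEOREMS ONLY (no definition,
no named fact, no instance, no `sorry`); Kato's cited matrix `ZetaBody` enters as the displayed HYPOTHESIS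
`hbody` (never obtained); nothing is booked; 19599 / 19077 / 19560 stay OPEN; BSD is not proved by any of this.
Credit: the expansion / congruence machine is n1011's (cell `b2b-bsdres`, seat p15:
`EulerFactorComparison.prod_deriv_mul_plusAvatar_sub_eq_sum`, `sum_mem_map_of_images`,
`exists_mem_map_eq_prod_sub_prod`), used BY NAME; the proof of §1 is p15's
`prod_deriv_mul_plusAvatar_sub_mem_map_span` with one change (the twist is factored, see below), the proof of
§2 is p15's `…_of_zetaBody` wrapper verbatim up to that change.

## Why (the off-Kato-stratum port of W2 at a good ANOMALOUS `3`: `a₃ ∈ {1, −2}`, `#Ẽ(𝔽₃) ∈ {3, 6}`, `t = 0`)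

n1011's derivative congruence (PK-4b-C) reads `∏D · (n•(1+δ₋₁)X − Θ·V) ∈ p^K ℤ_p[(ℤ/n)ˣ]` for an INTEGRAL
lift `V` of the twist `Vq = (1+δ₋₁)·uκδ_{u⁻¹}·∏_{q∣pA}E_q(σ_q⁻¹)·C⁻`, `E_q(X) = 1 − (a_q/q)X + (𝟙_{q∤N}/q)X²`.
At an additive `p` the factor `E_p` is `1`; at a good NON-anomalous / multiplicative `p` the seat's gen 8 used
the `p`-scaled body, whose twist `p·Vq` is integral with UNIT augmentation (`p + 𝟙 − a_p` a unit).  At a good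
ANOMALOUS `p` (`p ∣ #Ẽ(𝔽_p) = p + 1 − a_p`) the augmentation of `p·E_p(σ_p⁻¹) = p − a_pσ_p⁻¹ + σ_p⁻²` is NOT a
unit, and reading the congruence in `p^K ℤ_p[(ℤ/n)ˣ]` loses a digit.  THE REPAIR (this seat, gen 9): the
semi-local dual-exponential lattice over an unramified `K/ℚ_p` with `E(K)[p] = 0` is NOT `(#Ẽ(k)/p)·𝓞_K`
(Kim AJM 148 Cor. 3.5's display, wrong for `[K:ℚ_p] > 1` by an index count) but the Euler-factor lattice
`exp*_ω(H¹(K,T)) = E_p(φ⁻¹)·𝓞_K` (`φ` the arithmetic Frobenius; from `(φ² − a_pφ + p)·E(K) ⊆ Ê(𝔪_K)`,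
`log_ω Ê(𝔪_K) = p𝓞_K`, the index `#Ẽ(k)[p^∞]` on both sides, and trace duality) — FREE of rank one over
`ℤ_p[Gal(K/ℚ_p)]` with basis `E_p(φ⁻¹)·ξ`.  Kato's `p`-depleted value carries the SAME operator `E_p(σ_p⁻¹)`
(n1011's `E_p` inside `Vq`), so the right currency for the congruence at an anomalous `p` is
`P · p^K ℤ_p[(ℤ/n)ˣ]` with `P = p − a_pδ_{[p]⁻¹} + 𝟙δ_{[p]⁻²}` KEPT AS A FACTOR: this file proves
`∏D · ((p·n)•(1+δ₋₁)X − Θ·P·V′) = P·Y` with `Y ∈ p^K ℤ_p[(ℤ/n)ˣ]`, where `V′` is an integral lift of the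
twist WITHOUT its `p`-Euler factor (`p·Vq = P_ℚ·Vq′`).  Proof: in p15's ★ EXPANSION every summand carries the
twist `Vq` as a factor; scale by `p`, substitute `p·Vq = P_ℚ·Vq′`, pull `P_ℚ` out of the sum, and read the
remaining sum integrally with p15's `sum_mem_map_of_images` (lifts of `Vq′·Θ_e` instead of `Vq·Θ_e`).
The sequel files turn this into the value rows on the twisted lattice `(1 ⊗ (p − a_pσ_p⁻¹ + 𝟙σ_p⁻²))·L_int`
and feed a (P-EXP) rider whose scalar clause is stated on that lattice (true for Kato's witnesses by the
lattice lemma above; recorded in the seat memo, not used in the kernel).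

References: K. Kato, Astérisque 295 (2004) Thm. 6.6 (1) p. 163, §6.2 p. 161, Thm. 9.7 p. 189
[Kato2004Asterisque]; C.-H. Kim, AJM 148 (2026) = arXiv:2203.12159, Lemma 3.4, Cor. 3.5, §3.4–3.5 and the
proof of Thm. 3.13 [Kim2022StructureSelmer]; K. Rubin, *Euler Systems* (2000) §4.4, §9.6 [Rubin2000];
S. Bloch, K. Kato (1990) §3 [BlochKato1990].
-/

noncomputable section

-- the Theorems namespace of a single-conjunct summit repeats the summit name by design (D-0017)
set_option linter.dupNamespace false

open scoped BigOperators NumberField TensorProduct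
open Finset IsDedekindDomain NumberField MonoidAlgebra CongruenceSubgroup
open Literature.NumberTheory.GaloisRepresentations
open Literature.NumberTheory.EllipticCurves Literature.NumberTheory.EllipticCurves.ModularForms
open Literature.NumberTheory.EllipticCurves.Kato2004
open Literature.NumberTheory.EllipticCurves.Kato2004.EulerSystemValues Rat.HeightOneSpectrum
open Summit.BirchSwinnertonDyer.Rank1Residual.GaloisImage
open Summit.BirchSwinnertonDyer.Rank1Residual.GaloisImage.EulerFactorComparison

namespace Summit.BirchSwinnertonDyer.BirchSwinnertonDyer.Theorems.KimAtThreeShallowEqDeepAnomalousCongruence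

/-! ### §1 The congruence with the twist FACTORED (`c₁ • Vq = P_ℚ · Vq′`), prime-indexed -/

section Generic

variable {ι : Type*} [Fintype ι] [DecidableEq ι] (ℓ : ι → ℕ) [hℓ : ∀ i, Fact (ℓ i).Prime]
  (hinj : Function.Injective ℓ) {n : ℕ} [NeZero n] (hn : ∏ i, ℓ i = n)
  {N : ℕ} [NeZero N] (f : CuspForm (Gamma0 N) 2)

set_option backward.isDefEq.respectTransparency false in
include hinj in
/-- **★★ THE DERIVATIVE CONGRUENCE WITH THE TWIST FACTORED.**  Data as in n1011-p15's
`EulerFactorComparison.prod_deriv_mul_plusAvatar_sub_mem_map_span` (value law `hval` DISPLAYED, depletion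
modulus `M`), except that the twist `Vq` is NOT asked to be `p`-integral: instead a rational scalar `c₁` and a
factorisation `c₁ • Vq = P_ℚ · Vq′` in `ℚ[(ℤ/n)ˣ]` are displayed together with integral lifts `P` of `P_ℚ` and
`V′` of `Vq′` (intended: `c₁ = p`, `P_ℚ = p·E_p(δ_{[p]⁻¹}) = p − a_pδ_{[p]⁻¹} + 𝟙δ_{[p]⁻²}`, `Vq′` the twist with
the `p`-Euler factor removed).  Then
`(∏_i Σ_{j<ℓ_i−1} j δ_{b_i^j}) · (((c₁·n) • (1 + δ₋₁)·X)^{ℚ_p} − (Θ·(P·V′))^{ℚ_p}) = (P·Y)^{ℚ_p}` for some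
`Y ∈ p^K ℤ_p[(ℤ/n)ˣ]` — the factor `P` SURVIVES on the right.  Proof: p15's ★ EXPANSION carries `Vq` in every
summand; scale by `c₁`, factor, and read the cofactor of `P_ℚ` integrally by p15's `sum_mem_map_of_images`.
[cite: Kim2022StructureSelmer, the proof of Thm. 3.13 (arXiv v3 pp. 26–28; = Thm. 3.11 of AJM 148)]
[cite: Kato2004Asterisque, Thm. 6.6 (1) (p. 163) and §6.2 (p. 161)] [cite: Rubin2000, §9.6 and §4.4] -/
theorem prod_deriv_mul_plusAvatar_sub_eq_factor_mul (hf : IsNewform0 f) (hQ : coeffField f = ⊥)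
    (hℓN : ∀ i, ¬ ℓ i ∣ N) (aℓ : ι → ℤ) (ha : ∀ i, cuspCoeff f (ℓ i) = aℓ i)
    (x : CyclotomicField n ℚ) (X : MonoidAlgebra ℚ (ZMod n)ˣ)
    (hxX : x = ∑ g : (ZMod n)ˣ, X.coeff g •
      sigma n g (IsCyclotomicExtension.zeta n ℚ (CyclotomicField n ℚ)))
    (ιe : CyclotomicField n ℚ →+* ℂ) (u : (ZMod n)ˣ)
    (hι : ιe (IsCyclotomicExtension.zeta n ℚ (CyclotomicField n ℚ)) =
      Complex.exp (2 * Real.pi * Complex.I * ((u : ZMod n).val : ℂ) / n))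
    (κ : ℚ) {M : ℕ} (hM0 : M ≠ 0) (hM : M.Coprime n) (c d a : ℤ) (A : ℕ) (d' : ℤ)
    (hval : ∀ {n₀ : ℕ} [NeZero n₀] (hn₀ : n₀ ∣ n) {χ₀ : DirichletCharacter ℂ n₀},
      χ₀.IsPrimitive → χ₀ (-1) = 1 →
      charSum n ιe (DirichletCharacter.changeLevel hn₀ χ₀) x =
        (κ : ℂ) * ((∏ q ∈ (n * M).primeFactors.filter (fun q => ¬ q ∣ n₀),
            (1 - χ₀ (q : ZMod n₀) * cuspCoeff f q * (q : ℂ) ^ (-(1 : ℂ)) +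
              (if q ∣ N then 0 else (q : ℂ)) * χ₀ (q : ZMod n₀) ^ 2 * ((q : ℂ) ^ (-(1 : ℂ))) ^ 2)) *
          ((∑ b : ZMod n₀, χ₀⁻¹ b * ((ratPlusSymbol f ((b.val : ℚ) / n₀) : ℚ) : ℂ)) /
            gaussSum χ₀⁻¹ (ZMod.stdAddChar (N := n₀)))) *
        cuspFactor f true (fun j => (DirichletCharacter.changeLevel hn₀ χ₀)⁻¹ (j : ZMod n)) c d a A d')
    (lam : ι → (ZMod n)ˣ)
    (hlam : ∀ j, ((ZMod.unitsMap (prod_dvd_of_prod_eq ℓ hn (univ.erase j)) (lam j) :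
      (ZMod (∏ i ∈ univ.erase j, ℓ i))ˣ) : ZMod (∏ i ∈ univ.erase j, ℓ i)) =
        (ℓ j : ZMod (∏ i ∈ univ.erase j, ℓ i)))
    (b : ι → (ZMod n)ˣ) (hb : ∀ i, b i ∈ (ZMod.unitsMap (prod_dvd_of_prod_eq ℓ hn (univ.erase i))).ker)
    (Nq Dq gq Kq Mq : ι → MonoidAlgebra ℚ (ZMod n)ˣ)
    (hNq : ∀ i, Nq i = ∑ h ∈ univ.filter (· ∈ (ZMod.unitsMap (prod_dvd_of_prod_eq ℓ hn (univ.erase i))).ker),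
      single h (1 : ℚ))
    (hDq : ∀ i, Dq i = ∑ j ∈ range (ℓ i - 1), single (b i ^ j) ((j : ℕ) : ℚ))
    (hgq : ∀ i, gq i = algebraMap ℚ _ (((ℓ i : ℚ) - 2) / 2))
    (hKq : ∀ i, Kq i = algebraMap ℚ _ (aℓ i : ℚ) - single (lam i)⁻¹ (1 : ℚ) - single (lam i) (ℓ i : ℚ))
    (hMq : ∀ i, Mq i = algebraMap ℚ _ (aℓ i : ℚ) - single (lam i) (1 : ℚ) - single (lam i)⁻¹ (1 : ℚ))
    (uq : ℕ → (ZMod n)ˣ) (huq : ∀ q ∈ M.primeFactors, ((uq q : (ZMod n)ˣ) : ZMod n) = q)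
    (aM : ℕ → ℤ) (haM : ∀ q ∈ M.primeFactors, cuspCoeff f q = aM q)
    (Eq : MonoidAlgebra ℚ (ZMod n)ˣ)
    (hEq : Eq = ∏ q ∈ M.primeFactors, (1 - single (uq q)⁻¹ ((aM q : ℚ) / q) +
      single ((uq q)⁻¹ ^ 2) (if q ∣ N then 0 else (1 / q : ℚ))))
    (uc ud : (ZMod n)ˣ) (huc : (uc : ZMod n) = c) (hud : (ud : ZMod n) = d)
    (Cq : MonoidAlgebra ℚ (ZMod n)ˣ)
    (hCq : Cq = algebraMap ℚ _ ((c : ℚ) ^ 2 * (d : ℚ) ^ 2 * ratMinusSymbol f ((a : ℚ) / A)) -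
      single uc ((c : ℚ) * (d : ℚ) ^ 2 * ratMinusSymbol f ((a * c : ℚ) / A)) -
      single ud ((c : ℚ) ^ 2 * (d : ℚ) * ratMinusSymbol f ((a * d' : ℚ) / A)) +
      single (uc * ud) ((c : ℚ) * (d : ℚ) * ratMinusSymbol f ((a * c * d' : ℚ) / A)))
    (Vq : MonoidAlgebra ℚ (ZMod n)ˣ)
    (hVq : Vq = (1 + single (-1 : (ZMod n)ˣ) (1 : ℚ)) * single u⁻¹ κ * Eq * Cq)
    (Θq : Finset ι → MonoidAlgebra ℚ (ZMod n)ˣ)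
    (hΘq : ∀ d : Finset ι,
      haveI : NeZero (∏ i ∈ d, ℓ i) := ⟨Finset.prod_ne_zero_iff.mpr fun i _ => (hℓ i).out.ne_zero⟩
      Θq d = ∑ g : (ZMod n)ˣ, single g (ratPlusSymbol f
        ((((ZMod.unitsMap (prod_dvd_of_prod_eq ℓ hn d) g : (ZMod (∏ i ∈ d, ℓ i))ˣ) :
          ZMod (∏ i ∈ d, ℓ i)).val : ℚ) / (∏ i ∈ d, ℓ i : ℕ))))
    (p : ℕ) [Fact p.Prime] (hp2 : p ≠ 2) (K : ℕ) (hKℓ : ∀ i, p ^ K ∣ ℓ i - 1)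
    (hint : ∀ m : ℕ, m ∣ n → ∀ t : ℕ, ‖((ratPlusSymbol f ((t : ℚ) / m) : ℚ) : ℚ_[p])‖ ≤ 1)
    (Θ : MonoidAlgebra ℤ_[p] (ZMod n)ˣ)
    (hΘ : ∀ g : (ZMod n)ˣ, ((Θ.coeff g : ℤ_[p]) : ℚ_[p]) =
      ((ratPlusSymbol f (((g : ZMod n).val : ℚ) / n) : ℚ) : ℚ_[p]))
    -- the twist FACTORED: `c₁ • Vq = P_ℚ · Vq′`, with integral lifts `P` of `P_ℚ` and `V′` of `Vq′`
    (c₁ : ℚ) (Pq Vq' : MonoidAlgebra ℚ (ZMod n)ˣ) (hfac : algebraMap ℚ _ c₁ * Vq = Pq * Vq')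
    (P V' : MonoidAlgebra ℤ_[p] (ZMod n)ˣ)
    (hP : MonoidAlgebra.mapRingHom (ZMod n)ˣ (PadicInt.Coe.ringHom (p := p)) P =
      MonoidAlgebra.mapRingHom (ZMod n)ˣ (algebraMap ℚ ℚ_[p]) Pq)
    (hV' : MonoidAlgebra.mapRingHom (ZMod n)ˣ (PadicInt.Coe.ringHom (p := p)) V' =
      MonoidAlgebra.mapRingHom (ZMod n)ˣ (algebraMap ℚ ℚ_[p]) Vq') :
    ∃ Y ∈ Ideal.span {((p : MonoidAlgebra ℤ_[p] (ZMod n)ˣ)) ^ K},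
      (∏ i, ∑ j : Fin (ℓ i - 1), MonoidAlgebra.single (b i ^ (j : ℕ)) ((j : ℕ) : ℚ_[p])) *
          (MonoidAlgebra.mapRingHom (ZMod n)ˣ (algebraMap ℚ ℚ_[p])
              ((c₁ * n : ℚ) • ((1 + MonoidAlgebra.single (-1 : (ZMod n)ˣ) (1 : ℚ)) * X)) -
            MonoidAlgebra.mapRingHom (ZMod n)ˣ (PadicInt.Coe.ringHom (p := p)) (Θ * (P * V'))) =
        MonoidAlgebra.mapRingHom (ZMod n)ˣ (PadicInt.Coe.ringHom (p := p)) (P * Y) := by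
  classical
  have hE1 := prod_deriv_mul_plusAvatar_sub_eq_sum ℓ hinj hn f hf hQ hℓN aℓ ha x X hxX ιe u hι κ hM0 hM c d a
    A d' hval lam hlam b hb Nq Dq gq Kq Mq hNq hDq hgq hKq hMq uq huq aM haM Eq hEq uc ud huc hud Cq hCq
    Vq hVq Θq hΘq
  -- scale the expansion by `c₁` and factor the twist: `P_ℚ` comes out of the sum
  rw [Algebra.smul_def] at hE1
  have hE2 : (∏ i, Dq i) *
      ((c₁ * n : ℚ) • ((1 + single (-1 : (ZMod n)ˣ) (1 : ℚ)) * X) - Pq * Vq' * Θq univ) =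
      Pq * ∑ U ∈ (univ : Finset ι).powerset.erase ∅, (∏ i ∈ U, gq i) *
        ((∏ i ∈ univ \ U, (Dq i - gq i * Nq i)) *
          (((∏ i ∈ U, Kq i) - ∏ i ∈ U, Mq i) * (Vq' * Θq (univ \ U)))) := by
    calc (∏ i, Dq i) * ((c₁ * n : ℚ) • ((1 + single (-1 : (ZMod n)ˣ) (1 : ℚ)) * X) - Pq * Vq' * Θq univ)
        = algebraMap ℚ _ c₁ * ((∏ i, Dq i) *
            (algebraMap ℚ _ (n : ℚ) * ((1 + single (-1 : (ZMod n)ˣ) (1 : ℚ)) * X) - Vq * Θq univ)) := by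
          rw [Algebra.smul_def, map_mul, ← hfac]; ring
      _ = algebraMap ℚ _ c₁ * ∑ U ∈ (univ : Finset ι).powerset.erase ∅, (∏ i ∈ U, gq i) *
            ((∏ i ∈ univ \ U, (Dq i - gq i * Nq i)) *
              (((∏ i ∈ U, Kq i) - ∏ i ∈ U, Mq i) * (Vq * Θq (univ \ U)))) := by rw [hE1]
      _ = Pq * ∑ U ∈ (univ : Finset ι).powerset.erase ∅, (∏ i ∈ U, gq i) *
            ((∏ i ∈ univ \ U, (Dq i - gq i * Nq i)) *
              (((∏ i ∈ U, Kq i) - ∏ i ∈ U, Mq i) * (Vq' * Θq (univ \ U)))) := by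
          rw [Finset.mul_sum, Finset.mul_sum]
          refine Finset.sum_congr rfl fun U _ => ?_
          calc algebraMap ℚ _ c₁ * ((∏ i ∈ U, gq i) * ((∏ i ∈ univ \ U, (Dq i - gq i * Nq i)) *
                  (((∏ i ∈ U, Kq i) - ∏ i ∈ U, Mq i) * (Vq * Θq (univ \ U)))))
              = (∏ i ∈ U, gq i) * ((∏ i ∈ univ \ U, (Dq i - gq i * Nq i)) *
                  (((∏ i ∈ U, Kq i) - ∏ i ∈ U, Mq i) * ((algebraMap ℚ _ c₁ * Vq) * Θq (univ \ U)))) := by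
                ring
            _ = Pq * ((∏ i ∈ U, gq i) * ((∏ i ∈ univ \ U, (Dq i - gq i * Nq i)) *
                  (((∏ i ∈ U, Kq i) - ∏ i ∈ U, Mq i) * (Vq' * Θq (univ \ U))))) := by
                rw [hfac]; ring
  -- the two coefficient maps (the cofactor sum is kept folded under `mapRingHom`)
  have hE2p := congrArg (MonoidAlgebra.mapRingHom (ZMod n)ˣ (algebraMap ℚ ℚ_[p])) hE2
  rw [map_mul, map_sub, map_prod, map_mul, map_mul, map_mul] at hE2p
  -- identify the left-hand side
  have hD : ∀ i, MonoidAlgebra.mapRingHom (ZMod n)ˣ (algebraMap ℚ ℚ_[p]) (Dq i) =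
      ∑ j : Fin (ℓ i - 1), single (b i ^ (j : ℕ)) ((j : ℕ) : ℚ_[p]) := fun i => by
    rw [Fin.sum_univ_eq_sum_range (fun j => single (b i ^ j) ((j : ℕ) : ℚ_[p])) (ℓ i - 1), hDq i, map_sum]
    exact Finset.sum_congr rfl fun j _ => by rw [MonoidAlgebra.mapRingHom_single, map_natCast]
  have hΘp : MonoidAlgebra.mapRingHom (ZMod n)ˣ (PadicInt.Coe.ringHom (p := p)) Θ =
      MonoidAlgebra.mapRingHom (ZMod n)ˣ (algebraMap ℚ ℚ_[p]) (Θq univ) := by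
    rw [eq_sum_single_coeff Θ, map_sum, hΘq univ, map_sum]
    refine Finset.sum_congr rfl fun g _ => ?_
    rw [MonoidAlgebra.mapRingHom_single, MonoidAlgebra.mapRingHom_single, eq_ratCast,
      val_unitsMap_eq_of_eq hn (prod_dvd_of_prod_eq ℓ hn univ) g, hn]
    exact congrArg _ (hΘ g)
  -- integrality of the cofactor (PK-4b-C3 `sum_mem_map_of_images`, with `V′` in place of `V`)
  have h2 : IsUnit ((2 : ℕ) : ℤ_[p]) := by
    rw [PadicInt.isUnit_iff, PadicInt.norm_def, PadicInt.coe_natCast, Padic.norm_natCast_eq_one_iff]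
    exact (Nat.coprime_primes Fact.out Nat.prime_two).mpr hp2
  obtain ⟨w2, hw2⟩ := h2.exists_left_inv
  rw [Nat.cast_ofNat] at hw2
  have hw2' : (w2 : ℚ_[p]) * 2 = 1 := by
    have h := congrArg (PadicInt.Coe.ringHom (p := p)) hw2
    rw [map_mul, map_one, map_ofNat] at h
    exact h
  have hg : ∀ i, ∃ z : MonoidAlgebra ℤ_[p] (ZMod n)ˣ,
      MonoidAlgebra.mapRingHom (ZMod n)ˣ (PadicInt.Coe.ringHom (p := p)) z =
        MonoidAlgebra.mapRingHom (ZMod n)ˣ (algebraMap ℚ ℚ_[p]) (gq i) := fun i => by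
    refine ⟨algebraMap ℤ_[p] _ ((((ℓ i : ℤ) - 2 : ℤ) : ℤ_[p]) * w2), ?_⟩
    rw [mapRingHom_coe_algebraMap, hgq i, mapRingHom_algebraMap_algebraMap, PadicInt.coe_mul,
      PadicInt.coe_intCast]
    congr 1
    push_cast
    linear_combination (((ℓ i : ℚ_[p]) - 2) / 2) * hw2'
  choose zg hzg using hg
  have hDz : ∀ i, ∃ z : MonoidAlgebra ℤ_[p] (ZMod n)ˣ,
      MonoidAlgebra.mapRingHom (ZMod n)ˣ (PadicInt.Coe.ringHom (p := p)) z =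
        MonoidAlgebra.mapRingHom (ZMod n)ˣ (algebraMap ℚ ℚ_[p]) (Dq i) -
          MonoidAlgebra.mapRingHom (ZMod n)ˣ (algebraMap ℚ ℚ_[p]) (gq i) *
            MonoidAlgebra.mapRingHom (ZMod n)ˣ (algebraMap ℚ ℚ_[p]) (Nq i) := fun i => by
    have h1 : MonoidAlgebra.mapRingHom (ZMod n)ˣ (PadicInt.Coe.ringHom (p := p))
        (∑ j ∈ range (ℓ i - 1), single (b i ^ j) ((j : ℕ) : ℤ_[p])) =
        MonoidAlgebra.mapRingHom (ZMod n)ˣ (algebraMap ℚ ℚ_[p]) (Dq i) := by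
      rw [hDq i, map_sum, map_sum]
      exact Finset.sum_congr rfl fun j _ => by
        rw [MonoidAlgebra.mapRingHom_single, MonoidAlgebra.mapRingHom_single, map_natCast, map_natCast]
    have h2 : MonoidAlgebra.mapRingHom (ZMod n)ˣ (PadicInt.Coe.ringHom (p := p))
        (∑ h ∈ univ.filter (· ∈ (ZMod.unitsMap (prod_dvd_of_prod_eq ℓ hn (univ.erase i))).ker),
          single h (1 : ℤ_[p])) =
        MonoidAlgebra.mapRingHom (ZMod n)ˣ (algebraMap ℚ ℚ_[p]) (Nq i) := by
      rw [hNq i, map_sum, map_sum]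
      exact Finset.sum_congr rfl fun h _ => by
        rw [MonoidAlgebra.mapRingHom_single, MonoidAlgebra.mapRingHom_single, map_one, map_one]
    exact ⟨(∑ j ∈ range (ℓ i - 1), single (b i ^ j) ((j : ℕ) : ℤ_[p])) - zg i *
      ∑ h ∈ univ.filter (· ∈ (ZMod.unitsMap (prod_dvd_of_prod_eq ℓ hn (univ.erase i))).ker),
        single h (1 : ℤ_[p]), by rw [map_sub, map_mul, hzg i, h1, h2]⟩
  have hKM : ∀ U : Finset ι, U ≠ ∅ → ∃ z ∈ Ideal.span {((p : MonoidAlgebra ℤ_[p] (ZMod n)ˣ)) ^ K},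
      MonoidAlgebra.mapRingHom (ZMod n)ˣ (PadicInt.Coe.ringHom (p := p)) z =
        (∏ i ∈ U, MonoidAlgebra.mapRingHom (ZMod n)ˣ (algebraMap ℚ ℚ_[p]) (Kq i)) -
          ∏ i ∈ U, MonoidAlgebra.mapRingHom (ZMod n)ˣ (algebraMap ℚ ℚ_[p]) (Mq i) := fun U _ => by
    refine exists_mem_map_eq_prod_sub_prod _ _ _ _
      (fun i => algebraMap ℤ_[p] _ (aℓ i : ℤ_[p]) - single (lam i)⁻¹ (1 : ℤ_[p]) - single (lam i) (ℓ i : ℤ_[p]))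
      (fun i => algebraMap ℤ_[p] _ (aℓ i : ℤ_[p]) - single (lam i) (1 : ℤ_[p]) - single (lam i)⁻¹ (1 : ℤ_[p]))
      U (fun i _ => ?_) (fun i _ => ?_) (fun i _ => ?_)
    · rw [hKq i]
      simp only [map_sub, mapRingHom_coe_algebraMap, mapRingHom_algebraMap_algebraMap,
        MonoidAlgebra.mapRingHom_single, map_one, map_natCast, PadicInt.coe_intCast, Rat.cast_intCast]
    · rw [hMq i]
      simp only [map_sub, mapRingHom_coe_algebraMap, mapRingHom_algebraMap_algebraMap,
        MonoidAlgebra.mapRingHom_single, map_one, PadicInt.coe_intCast, Rat.cast_intCast]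
    · obtain ⟨t, ht⟩ := hKℓ i
      have hℓt : (ℓ i : ℤ_[p]) = (p : ℤ_[p]) ^ K * t + 1 := by
        have h1 : 1 ≤ ℓ i := (hℓ i).out.one_lt.le
        have h' : ((ℓ i - 1 : ℕ) : ℤ_[p]) + 1 = (p : ℤ_[p]) ^ K * t + 1 := by rw [ht]; push_cast; ring
        rwa [Nat.cast_sub h1, Nat.cast_one, sub_add_cancel] at h'
      refine Ideal.mem_span_singleton'.mpr ⟨-single (lam i) (t : ℤ_[p]), ?_⟩
      rw [MonoidAlgebra.natCast_def, MonoidAlgebra.single_pow, one_pow, neg_mul, single_mul_single, mul_one,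
        hℓt]
      have h' : single (lam i) (1 : ℤ_[p]) - single (lam i) ((p : ℤ_[p]) ^ K * t + 1) =
          -single (lam i) ((t : ℤ_[p]) * (p : ℤ_[p]) ^ K) := by
        rw [← MonoidAlgebra.single_sub, ← MonoidAlgebra.single_neg]
        congr 1
        ring
      rw [← h']
      ring
  have hY : ∀ e : Finset ι, ∃ z : MonoidAlgebra ℤ_[p] (ZMod n)ˣ,
      MonoidAlgebra.mapRingHom (ZMod n)ˣ (PadicInt.Coe.ringHom (p := p)) z =
        MonoidAlgebra.mapRingHom (ZMod n)ˣ (algebraMap ℚ ℚ_[p]) Vq' *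
          MonoidAlgebra.mapRingHom (ZMod n)ˣ (algebraMap ℚ ℚ_[p]) (Θq e) := fun e => by
    haveI : NeZero (∏ i ∈ e, ℓ i) := ⟨Finset.prod_ne_zero_iff.mpr fun i _ => (hℓ i).out.ne_zero⟩
    let θz : (ZMod n)ˣ → ℤ_[p] := fun g => ⟨((ratPlusSymbol f
      ((((ZMod.unitsMap (prod_dvd_of_prod_eq ℓ hn e) g : (ZMod (∏ i ∈ e, ℓ i))ˣ) :
        ZMod (∏ i ∈ e, ℓ i)).val : ℚ) / (∏ i ∈ e, ℓ i : ℕ)) : ℚ) : ℚ_[p]),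
      hint _ (prod_dvd_of_prod_eq ℓ hn e) _⟩
    have hθz : ∀ g, PadicInt.Coe.ringHom (p := p) (θz g) = algebraMap ℚ ℚ_[p] (ratPlusSymbol f
        ((((ZMod.unitsMap (prod_dvd_of_prod_eq ℓ hn e) g : (ZMod (∏ i ∈ e, ℓ i))ˣ) :
          ZMod (∏ i ∈ e, ℓ i)).val : ℚ) / (∏ i ∈ e, ℓ i : ℕ))) := fun g => by
      rw [eq_ratCast]; rfl
    have hΘz : MonoidAlgebra.mapRingHom (ZMod n)ˣ (PadicInt.Coe.ringHom (p := p))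
        (∑ g : (ZMod n)ˣ, single g (θz g)) =
        MonoidAlgebra.mapRingHom (ZMod n)ˣ (algebraMap ℚ ℚ_[p]) (Θq e) := by
      rw [hΘq e, map_sum, map_sum]
      exact Finset.sum_congr rfl fun g _ => by
        rw [MonoidAlgebra.mapRingHom_single, MonoidAlgebra.mapRingHom_single, hθz g]
    exact ⟨V' * ∑ g : (ZMod n)ˣ, single g (θz g), by rw [map_mul, hV', hΘz]⟩
  have hcof : MonoidAlgebra.mapRingHom (ZMod n)ˣ (algebraMap ℚ ℚ_[p])
      (∑ U ∈ (univ : Finset ι).powerset.erase ∅, (∏ i ∈ U, gq i) *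
        ((∏ i ∈ univ \ U, (Dq i - gq i * Nq i)) *
          (((∏ i ∈ U, Kq i) - ∏ i ∈ U, Mq i) * (Vq' * Θq (univ \ U))))) ∈
      (Ideal.span {((p : MonoidAlgebra ℤ_[p] (ZMod n)ˣ)) ^ K}).toAddSubmonoid.map
        (MonoidAlgebra.mapRingHom (ZMod n)ˣ (PadicInt.Coe.ringHom (p := p)) :
          MonoidAlgebra ℤ_[p] (ZMod n)ˣ →+ MonoidAlgebra ℚ_[p] (ZMod n)ˣ) := by
    simp only [map_sum, map_mul, map_prod, map_sub]
    exact sum_mem_map_of_images (MonoidAlgebra.mapRingHom (ZMod n)ˣ (PadicInt.Coe.ringHom (p := p))) _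
      (fun i => MonoidAlgebra.mapRingHom (ZMod n)ˣ (algebraMap ℚ ℚ_[p]) (gq i))
      (fun i => MonoidAlgebra.mapRingHom (ZMod n)ˣ (algebraMap ℚ ℚ_[p]) (Dq i) -
        MonoidAlgebra.mapRingHom (ZMod n)ˣ (algebraMap ℚ ℚ_[p]) (gq i) *
          MonoidAlgebra.mapRingHom (ZMod n)ˣ (algebraMap ℚ ℚ_[p]) (Nq i))
      (fun U => (∏ i ∈ U, MonoidAlgebra.mapRingHom (ZMod n)ˣ (algebraMap ℚ ℚ_[p]) (Kq i)) -
        ∏ i ∈ U, MonoidAlgebra.mapRingHom (ZMod n)ˣ (algebraMap ℚ ℚ_[p]) (Mq i))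
      (fun e => MonoidAlgebra.mapRingHom (ZMod n)ˣ (algebraMap ℚ ℚ_[p]) Vq' *
        MonoidAlgebra.mapRingHom (ZMod n)ˣ (algebraMap ℚ ℚ_[p]) (Θq e))
      (fun i => ⟨zg i, hzg i⟩) hDz hKM hY
  obtain ⟨Y, hYmem, hYeq⟩ := hcof
  refine ⟨Y, hYmem, ?_⟩
  have hYeq' : MonoidAlgebra.mapRingHom (ZMod n)ˣ (PadicInt.Coe.ringHom (p := p)) Y =
      MonoidAlgebra.mapRingHom (ZMod n)ˣ (algebraMap ℚ ℚ_[p])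
        (∑ U ∈ (univ : Finset ι).powerset.erase ∅, (∏ i ∈ U, gq i) *
          ((∏ i ∈ univ \ U, (Dq i - gq i * Nq i)) *
            (((∏ i ∈ U, Kq i) - ∏ i ∈ U, Mq i) * (Vq' * Θq (univ \ U))))) := hYeq
  -- assemble: LHS = (P_ℚ · cofactor)^{ℚ_p} = (P · Y)^{ℚ_p}
  rw [map_mul _ P Y, hYeq', hP, ← hE2p, map_mul _ Θ (P * V'), map_mul _ P V', hΘp, hP, hV',
    show (∏ i, ∑ j : Fin (ℓ i - 1), single (b i ^ (j : ℕ)) ((j : ℕ) : ℚ_[p])) =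
      ∏ i, MonoidAlgebra.mapRingHom (ZMod n)ˣ (algebraMap ℚ ℚ_[p]) (Dq i) from
      Finset.prod_congr rfl fun i _ => (hD i).symm]
  ring

end Generic


end Summit.BirchSwinnertonDyer.BirchSwinnertonDyer.Theorems.KimAtThreeShallowEqDeepAnomalousCongruence

end
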